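import Mathlib
import Summits.KontsevichZagierPeriods.Zeta5Search.DenomLaw.TS3RayPath
import Summits.KontsevichZagierPeriods.Zeta5Search.MinorTermwiseBounds
import Summits.KontsevichZagierPeriods.Zeta5Search.BigPrimeWindow
import HarnessLib

/-!
# ζ(5) search — (QV) and (P̂V) on TOP_STAIR #3 above `21.5n`, every direction `j`, all `n` (termwise class bounds + the TS3 covers)

Cell `pub-zeta5` (HONEST FRAMING: systematic search; no irrationality claim unless certified), TRACK «DENOM-LAW» D1 prover seat
(denom-prover-d1 g14, `HOME/denom-law/prover-d1/ATTEMPT-14.md` §3).  Two of gen-2 g5's four OBSERVED valuation laws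
(`QMinorValuationLaw`: `v_p(U W⁺ − U⁺ W) ≥ refund − N_p`; `PhatMinorValuationLaw`: `v_p(U V⁺ − U⁺ V) ≥ refund − 1 − N_p`) PROVED on
TOP_STAIR #3, `b(n) = n·(85; 35,32,30,27,25,22,20) = bRay ts3 n`, for every `n ≥ 1`, every `1 ≤ j ≤ 7` and every prime `p` with `2p > 43n`, from the
TERMWISE bounds of `MinorTermwiseBounds` (g12): the landed covers `TS3RayCellsA…M` cell by cell (`checkLB` data `(A,B) = (−7,−4) … (0,0)`, `N_p` from
`pairFloors_ts3`): (QV) with slack ≥ 1 below `43n`, (P̂V) tight on `(38n, 40n]` and `(41n, 43n]` — EXCEPT two cells: the (QV) UNIT on `43n < p ≤ 64n`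
(`refund = 1`, `N_p = 0`), which is the landed `W`-divisibility `BigPrime.one_le_padicValRat_coeffW_of_slots` (slots `20n ≤ 22n ≤ 25n`, `p ≥ 43n + 1`,
`p ≤ d + 1`) for `b(n)` and `b(n) + e_j` (`coeffW_small_of_ts3like`) times the `p`-integral `U`, `U⁺`; and (P̂V) on the THEOREM-V cell `40n < p ≤ 41n`, where
`v(V), v(V⁺) ≥ −N_p = −1` (THEOREM V) replaces the cover's `VB = −2` (`minorPhat_c40`).  Above `b₀ = 85n` by `ValuationLawsAboveB0`.  The range `2p ≤ 43n`
(counting) and the node-verbatim statements are `TS3RayMinorsAll`.  MODEL/structure-side valuation bookkeeping of the cell's own rationals; the ∀-b nodes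
stay OPEN; nothing about ζ(5); no γ; records UNMOVED.
-/

open Finset

namespace Summit.KontsevichZagierPeriods.Zeta5Search.StairTS3

open Summit.KontsevichZagierPeriods.Zeta5Search.ClusterValuation
open Summit.KontsevichZagierPeriods.Zeta5Search.CasoratianValuation (InPolytope shift casoratian pairFloors refund minorQ minorPhat)
open Summit.KontsevichZagierPeriods.Zeta5Search.WedgeDictionary (dOf coeffU coeffW coeffV)
open Summit.KontsevichZagierPeriods.Zeta5Search.DualSeries (InBox)
open Summit.KontsevichZagierPeriods.Zeta5Search.PadicSeries (one_le_p zpow_p_nonneg)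
open Summit.KontsevichZagierPeriods.Zeta5Search.BigPrime (shift_zero dOf_shift)
open Summit.KontsevichZagierPeriods.Zeta5Search.ClassTypeCover
open Summit.KontsevichZagierPeriods.Zeta5Search.StaircaseCells (bRay ts3)
open Summit.KontsevichZagierPeriods.Zeta5Search.CellA (classExp_le_classNu)
open Summit.KontsevichZagierPeriods.Zeta5Search.ClusterValuation.MinorBounds

variable {p : ℕ} [hp : Fact p.Prime]

/-! ## §1 The ray above `21.5n`, cell by cell -/

section Ray

variable {n j : ℕ} (hn : 1 ≤ n) (hj1 : 1 ≤ j) (hj7 : j ≤ 7) (hprime : p.Prime)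
include hn hj1 hj7 hprime

omit hprime in
/-- The cover step with explicit termwise exponents `u ≤ min(0, B+2)`, `w ≤ min(0, B)` (numerals supplied by the caller; the check at the actual parity flag). -/
theorem cell_minors_ts3 {TY : List (List ℤ × Bool)} (h43 : 43 * n < 2 * p) (hcov : Cover (bRay ts3 n) p TY)
    {A B : ℤ} (hchk : checkLB (decide (¬ (2 : ℤ) ∣ bRay ts3 n 0)) TY A B = true) (u w : ℤ) (hu0 : u ≤ 0) (huB : u ≤ B + 2) (hw0 : w ≤ 0) (hwB : w ≤ B) :
    (minorQ (bRay ts3 n) j ≠ 0 → u + w ≤ padicValRat p (minorQ (bRay ts3 n) j)) ∧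
    (minorPhat (bRay ts3 n) j ≠ 0 → u + A ≤ padicValRat p (minorPhat (bRay ts3 n) j)) := by
  obtain ⟨hp5, hwin⟩ := window43 hn h43
  obtain ⟨hA, hB⟩ := bounds_of_cover hcov hchk
  exact minors_of_bounds _ (inPolytope_ray n) hj1 (inPolytope_shift_ts3_j hn j hj1 hj7) hp5 hwin u w A hu0 hw0
    (fun x hx h2 => by have := hB x hx h2; omega) (fun x hx h2 => by have := hB x hx h2; omega) hA

omit hj1 hj7 in
/-- `p ∣ W(c)` for a TS3-LIKE vector `c` (`c₀ = 85n`; `c₁,…,c₅ ≥ 25n`; `c₆ ∈ [22n, 22n+1]`; `c₇ ∈ [20n, 20n+1]`) at `43n + 1 ≤ p ≤ d(c) + 1`: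
the landed `W`-divisibility `BigPrime.one_le_padicValRat_coeffW_of_slots` on the slots `c₇ ≤ c₆ ≤ c₅`. -/
theorem coeffW_small_of_ts3like (c : ℕ → ℤ) (hc : InPolytope c) (h0 : c 0 = 85 * n)
    (h6 : 22 * (n : ℤ) ≤ c 6 ∧ c 6 ≤ 22 * n + 1) (h7 : 20 * (n : ℤ) ≤ c 7 ∧ c 7 ≤ 20 * n + 1)
    (hbig : ∀ i ∈ range 5, 25 * (n : ℤ) ≤ c (i + 1)) (hp43 : 43 * n + 1 ≤ p) (hpd : (p : ℤ) ≤ dOf c + 1) :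
    padicNorm p (coeffW c) ≤ (p : ℚ) ^ (-(1 : ℤ)) := by
  refine padicNorm_le_of_val fun hW => ?_
  have hn1 : (1 : ℤ) ≤ n := by exact_mod_cast hn
  have hp' : (43 * n + 1 : ℤ) ≤ p := by exact_mod_cast hp43
  refine BigPrime.one_le_padicValRat_coeffW_of_slots c p 4 6 5 hc.1 hc.2.1 hc.2.2 (by simp) (by simp) (by simp) (by norm_num)
    (by linarith [h6.1, h7.2]) (fun k hk hk4 hk6 => ?_) hprime (by omega) (by rw [h0]; linarith [h6.1, h7.1]) hpd hW
  simp only [mem_range] at hk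
  have hb0 := hbig 0 (by simp); have hb1 := hbig 1 (by simp); have hb2 := hbig 2 (by simp); have hb3 := hbig 3 (by simp); have hb4 := hbig 4 (by simp)
  simp only [Nat.reduceAdd] at hb0 hb1 hb2 hb3 hb4
  interval_cases k
  · linarith [h6.2]
  · linarith [h6.2]
  · linarith [h6.2]
  · linarith [h6.2]
  · exact absurd rfl hk4
  · exact le_rfl
  · exact absurd rfl hk6

omit hn hj1 hj7 hprime in
/-- The ray TS3 is TS3-like. -/
theorem ts3like_ray : ((bRay ts3 n) 0 = 85 * n) ∧
    (22 * (n : ℤ) ≤ (bRay ts3 n) 6 ∧ (bRay ts3 n) 6 ≤ 22 * n + 1) ∧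
    (20 * (n : ℤ) ≤ (bRay ts3 n) 7 ∧ (bRay ts3 n) 7 ≤ 20 * n + 1) ∧
    (∀ i ∈ range 5, 25 * (n : ℤ) ≤ (bRay ts3 n) (i + 1)) := by
  refine ⟨w0 n, by rw [w6]; constructor <;> linarith, by rw [w7]; constructor <;> linarith, fun i hi => ?_⟩
  simp only [mem_range] at hi
  interval_cases i <;> simp only [Nat.reduceAdd, w1, w2, w3, w4, w5] <;> linarith

omit hn hprime in
/-- Every contiguous shift of the ray TS3 is TS3-like. -/
theorem ts3like_shift : ((shift (bRay ts3 n) j) 0 = 85 * n) ∧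
    (22 * (n : ℤ) ≤ (shift (bRay ts3 n) j) 6 ∧ (shift (bRay ts3 n) j) 6 ≤ 22 * n + 1) ∧
    (20 * (n : ℤ) ≤ (shift (bRay ts3 n) j) 7 ∧ (shift (bRay ts3 n) j) 7 ≤ 20 * n + 1) ∧
    (∀ i ∈ range 5, 25 * (n : ℤ) ≤ (shift (bRay ts3 n) j) (i + 1)) := by
  have hs : ∀ i, shift (bRay ts3 n) j i = if i = j then bRay ts3 n j + 1 else bRay ts3 n i := by
    intro i; simp only [shift, Function.update_apply]
  interval_cases j <;>
  · refine ⟨?_, ?_, ?_, fun i hi => ?_⟩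
    · rw [hs]; simp only [Nat.reduceEqDiff, if_false, w0]
    · simp only [hs, Nat.reduceEqDiff, if_true, if_false, w6]; constructor <;> linarith
    · simp only [hs, Nat.reduceEqDiff, if_true, if_false, w7]; constructor <;> linarith
    · simp only [mem_range] at hi
      interval_cases i <;> simp only [hs, Nat.reduceAdd, Nat.reduceEqDiff, if_true, if_false, w1, w2, w3, w4, w5] <;> linarith

/-- **(QV) needs a unit on `43n < p ≤ 64n`** (`refund = 1`, `N_p = 0`): there `p ∣ W(b(n))` and `p ∣ W(b(n)+e_j)` (`coeffW_small_of_ts3like`;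
`p ≥ 43n + 1`, `p ≤ d + 1` resp. `≤ d(b⁺) + 1 = 64n`), and `U`, `U⁺` are `p`-integral (every multipole class has `5 + E ≥ 0`). -/
theorem minorQ_c43 (hA : 43 * n < p) (hB : p ≤ 64 * n) (hne : minorQ (bRay ts3 n) j ≠ 0) :
    (1 : ℤ) ≤ padicValRat p (minorQ (bRay ts3 n) j) := by
  obtain ⟨hp5, hwin⟩ := window43 hn (by omega : 43 * n < 2 * p)
  have hp2 : p % 2 = 1 := Nat.odd_iff.1 (hprime.odd_of_ne_two (by omega))
  have hb : InPolytope (bRay ts3 n) := inPolytope_ray n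
  have hb' : InPolytope (shift (bRay ts3 n) j) := inPolytope_shift_ts3_j hn j hj1 hj7
  have h0' : shift (bRay ts3 n) j 0 = bRay ts3 n 0 := shift_zero _ hj1
  have hwin' : (shift (bRay ts3 n) j 0 + 2 : ℤ) < (p : ℤ) ^ 2 := by rw [h0']; exact hwin
  obtain ⟨-, hBm⟩ := bounds_of_cover (cover_c43 (n := n) (p := p) (by omega) (by omega) hp2) (checkM_c43 _)
  have hum : ∀ x, x < p → 2 ≤ classPoleCount (bRay ts3 n) p x → (0 : ℤ) ≤ 5 + classExp (bRay ts3 n) p x :=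
    fun x hx h2 => by have := hBm x hx h2; omega
  have hcnt : ∀ x, classPoleCount (shift (bRay ts3 n) j) p x ≤ classPoleCount (bRay ts3 n) p x :=
    fun x => classPoleCount_shift_le _ hb.1 hj1 p x
  have hum' : ∀ x, x < p → 2 ≤ classPoleCount (shift (bRay ts3 n) j) p x → (0 : ℤ) ≤ 5 + classExp (shift (bRay ts3 n) j) p x :=
    fun x hx h2 => (hum x hx (le_trans h2 (hcnt x))).trans (by linarith [classExp_shift_ge _ hb.1 hj1 p x])
  have hU := coeffU_norm_le _ hb hp5 hwin 0 le_rfl hum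
  have hU' := coeffU_norm_le _ hb' hp5 hwin' 0 le_rfl hum'
  obtain ⟨g0, g6, g7, gbig⟩ := ts3like_ray (n := n)
  obtain ⟨s0, s6, s7, sbig⟩ := ts3like_shift (n := n) (j := j) hj1 hj7
  have hW := coeffW_small_of_ts3like (p := p) hn hprime _ hb g0 g6 g7 gbig (by omega) (by rw [dOf_ts3]; omega)
  have hW' := coeffW_small_of_ts3like (p := p) hn hprime _ hb' s0 s6 s7 sbig (by omega)
    (by rw [dOf_shift _ hj1 hj7, dOf_ts3]; omega)
  apply val_ge_of_padicNorm_le hne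
  rw [minorQ, show (-(1 : ℤ)) = -((0 : ℤ) + 1) by norm_num]
  exact minor_norm_le hU hU' hW hW'

/-- **(P̂V) on the THEOREM-V cell `40n < p ≤ 41n`**: `v_p(U V⁺ − U⁺ V) ≥ −1 = refund − 1 − N_p` — `U`, `U⁺` are `p`-integral (rows `5 + E ≥ 3`) and
`v(V), v(V⁺) ≥ −N_p = −1` by THEOREM V (the cover's `VB = −2` would give only `−2`). -/
theorem minorPhat_c40 (hA : 40 * n < p) (hB : p ≤ 41 * n) (hne : minorPhat (bRay ts3 n) j ≠ 0) :
    (-1 : ℤ) ≤ padicValRat p (minorPhat (bRay ts3 n) j) := by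
  obtain ⟨hp5, hwin⟩ := window43 hn (by omega : 43 * n < 2 * p)
  have hp1 : (1 : ℚ) ≤ p := one_le_p
  have hp2 : p % 2 = 1 := Nat.odd_iff.1 (hprime.odd_of_ne_two (by omega))
  have hb : InPolytope (bRay ts3 n) := inPolytope_ray n
  have hb' : InPolytope (shift (bRay ts3 n) j) := inPolytope_shift_ts3_j hn j hj1 hj7
  have h0' : shift (bRay ts3 n) j 0 = bRay ts3 n 0 := shift_zero _ hj1
  have hwin' : (shift (bRay ts3 n) j 0 + 2 : ℤ) < (p : ℤ) ^ 2 := by rw [h0']; exact hwin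
  obtain ⟨-, hBm⟩ := bounds_of_cover (cover_c40 (n := n) (p := p) (by omega) (by omega) hp2) (checkM_c40 _)
  have hum : ∀ x, x < p → 2 ≤ classPoleCount (bRay ts3 n) p x → (0 : ℤ) ≤ 5 + classExp (bRay ts3 n) p x :=
    fun x hx h2 => by have := hBm x hx h2; omega
  have hcnt : ∀ x, classPoleCount (shift (bRay ts3 n) j) p x ≤ classPoleCount (bRay ts3 n) p x :=
    fun x => classPoleCount_shift_le _ hb.1 hj1 p x
  have hum' : ∀ x, x < p → 2 ≤ classPoleCount (shift (bRay ts3 n) j) p x → (0 : ℤ) ≤ 5 + classExp (shift (bRay ts3 n) j) p x :=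
    fun x hx h2 => (hum x hx (le_trans h2 (hcnt x))).trans (by linarith [classExp_shift_ge _ hb.1 hj1 p x])
  have hU := coeffU_norm_le _ hb hp5 hwin 0 le_rfl hum
  have hU' := coeffU_norm_le _ hb' hp5 hwin' 0 le_rfl hum'
  have hN : pairFloors (bRay ts3 n) p = 1 := N_c40 hA (by omega)
  have hN' : pairFloors (shift (bRay ts3 n) j) p ≤ 1 := hN ▸ pairFloors_shift_le _ hj1 p hprime.pos
  have hV : padicNorm p (coeffV (bRay ts3 n)) ≤ (p : ℚ) ^ (-(-1 : ℤ)) :=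
    (padicNorm_coeffV_le_pairFloors _ hb hp5 hwin).trans (by rw [hN]; norm_num)
  have hV' : padicNorm p (coeffV (shift (bRay ts3 n) j)) ≤ (p : ℚ) ^ (-(-1 : ℤ)) :=
    (padicNorm_coeffV_le_pairFloors _ hb' hp5 hwin').trans ((zpow_le_zpow_right₀ hp1 hN').trans (by norm_num))
  apply val_ge_of_padicNorm_le hne
  rw [minorPhat, show (-(-1 : ℤ)) = -((0 : ℤ) + (-1)) by norm_num]
  exact minor_norm_le hU hU' hV hV'

/-- **(QV) and (P̂V) at every prime with `2p > 43n`**, cell by cell (the `(A, B)` data of the landed covers; the two special cells above). -/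
theorem minors_gt43 (h43 : 43 * n < 2 * p) :
    (minorQ (bRay ts3 n) j ≠ 0 →
      refund (bRay ts3 n) p - pairFloors (bRay ts3 n) p ≤ padicValRat p (minorQ (bRay ts3 n) j)) ∧
    (minorPhat (bRay ts3 n) j ≠ 0 →
      refund (bRay ts3 n) p - 1 - pairFloors (bRay ts3 n) p ≤ padicValRat p (minorPhat (bRay ts3 n) j)) := by
  have hp0 : 0 < p := hprime.pos
  have hp2 := odd_of_prime_gt43 hprime h43 hn
  obtain ⟨hp5, hwin⟩ := window43 hn h43
  by_cases h85 : 85 * n < p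
  · have hpb : (bRay ts3 n) 0 + 1 ≤ (p : ℤ) := by rw [w0]; exact_mod_cast (show 85 * n + 1 ≤ p by omega)
    exact ⟨fun hne => BigPrime.qMinorValuationLaw_above _ j p (inPolytope_ray n) hj1 hj7 (inPolytope_shift_ts3_j hn j hj1 hj7) hprime hp5 hpb hne,
      fun hne => BigPrime.phatMinorValuationLaw_above _ j p (inPolytope_ray n) hj1 (inPolytope_shift_ts3_j hn j hj1 hj7) hprime hpb hne⟩
  by_cases h64 : 64 * n < p
  · rw [refund_ts3_zero h64, N_gt43 (by omega)]
    have hc := cell_minors_ts3 hn hj1 hj7 h43 (cover_c64 (by omega) (by omega) hp2) (checkM_c64 _) 0 0 le_rfl (by norm_num) le_rfl le_rfl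
    exact ⟨fun hne => by linarith [hc.1 hne], fun hne => by linarith [hc.2 hne]⟩
  push Not at h64
  rw [refund_ts3_one hp0 h64]
  by_cases h : p ≤ 23 * n
  · rw [N_c21 h43 h]
    have hc := cell_minors_ts3 hn hj1 hj7 h43 (cover_c21 h43 (by omega) hp2) (checkM_c21 _) (-2) (-4) (by norm_num) (by norm_num) (by norm_num) le_rfl
    exact ⟨fun hne => by linarith [hc.1 hne], fun hne => by linarith [hc.2 hne]⟩
  by_cases h' : p ≤ 25 * n
  · rw [N_c23 (by omega) h']
    have hc := cell_minors_ts3 hn hj1 hj7 h43 (cover_c23 (by omega) (by omega) hp2) (checkM_c23 _) (-1) (-3) (by norm_num) (by norm_num) (by norm_num) le_rfl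
    exact ⟨fun hne => by linarith [hc.1 hne], fun hne => by linarith [hc.2 hne]⟩
  by_cases h : p ≤ 26 * n
  · rw [N_c25 (by omega) h]
    have hc := cell_minors_ts3 hn hj1 hj7 h43 (cover_c23 (by omega) (by omega) hp2) (checkM_c23 _) (-1) (-3) (by norm_num) (by norm_num) (by norm_num) le_rfl
    exact ⟨fun hne => by linarith [hc.1 hne], fun hne => by linarith [hc.2 hne]⟩
  by_cases h' : p ≤ 28 * n
  · rw [N_c26 (by omega) h']
    have hc := cell_minors_ts3 hn hj1 hj7 h43 (cover_c23 (by omega) (by omega) hp2) (checkM_c23 _) (-1) (-3) (by norm_num) (by norm_num) (by norm_num) le_rfl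
    exact ⟨fun hne => by linarith [hc.1 hne], fun hne => by linarith [hc.2 hne]⟩
  by_cases h : 3 * p ≤ 85 * n
  · rw [N_c28 (by omega) (by omega)]
    have hc := cell_minors_ts3 hn hj1 hj7 h43 (cover_c28a (by omega) h hp2) (checkM_c28a _) 0 (-2) le_rfl (by norm_num) (by norm_num) le_rfl
    exact ⟨fun hne => by linarith [hc.1 hne], fun hne => by linarith [hc.2 hne]⟩
  by_cases h' : p ≤ 30 * n
  · rw [N_c28 (by omega) h']
    by_cases hn2 : n % 2 = 0
    · have hc := cell_minors_ts3 hn hj1 hj7 h43 (cover_c28b_ev (by omega) (by omega) hp2 hn2) (by rw [oddFlag_even hn2]; exact StairTS1.checkM_c11b)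
        (-1) (-3) (by norm_num) (by norm_num) (by norm_num) le_rfl
      exact ⟨fun hne => by linarith [hc.1 hne], fun hne => by linarith [hc.2 hne]⟩
    · have hn1 : n % 2 = 1 := by omega
      have hc := cell_minors_ts3 hn hj1 hj7 h43 (cover_c28b_od (by omega) (by omega) hp2 hn1) (by rw [oddFlag_odd hn1]; exact checkM_c28b_od)
        (-1) (-3) (by norm_num) (by norm_num) (by norm_num) le_rfl
      exact ⟨fun hne => by linarith [hc.1 hne], fun hne => by linarith [hc.2 hne]⟩
  by_cases h : p ≤ 31 * n
  · rw [N_c30 (by omega) h]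
    by_cases hn2 : n % 2 = 0
    · have hc := cell_minors_ts3 hn hj1 hj7 h43 (cover_c30_ev (by omega) (by omega) hp2 hn2) (by rw [oddFlag_even hn2]; exact checkM_c30_ev)
        (-1) (-3) (by norm_num) (by norm_num) (by norm_num) le_rfl
      exact ⟨fun hne => by linarith [hc.1 hne], fun hne => by linarith [hc.2 hne]⟩
    · have hn1 : n % 2 = 1 := by omega
      have hc := cell_minors_ts3 hn hj1 hj7 h43 (cover_c30_od (by omega) (by omega) hp2 hn1) (by rw [oddFlag_odd hn1]; exact checkM_c30_od)
        (-1) (-3) (by norm_num) (by norm_num) (by norm_num) le_rfl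
      exact ⟨fun hne => by linarith [hc.1 hne], fun hne => by linarith [hc.2 hne]⟩
  by_cases h' : p ≤ 32 * n
  · rw [N_c31 (by omega) (by omega)]
    have hc := cell_minors_ts3 hn hj1 hj7 h43 (cover_c31 (by omega) (by omega) hp2) (checkM_c31 _) 0 (-2) le_rfl (by norm_num) (by norm_num) le_rfl
    exact ⟨fun hne => by linarith [hc.1 hne], fun hne => by linarith [hc.2 hne]⟩
  by_cases h : p ≤ 33 * n
  · rw [N_c31 (by omega) h]
    have hc := cell_minors_ts3 hn hj1 hj7 h43 (cover_c32 (by omega) (by omega) hp2) (checkM_c32 _) 0 (-2) le_rfl (by norm_num) (by norm_num) le_rfl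
    exact ⟨fun hne => by linarith [hc.1 hne], fun hne => by linarith [hc.2 hne]⟩
  by_cases h' : p ≤ 35 * n
  · rw [N_c33 (by omega) h']
    have hc := cell_minors_ts3 hn hj1 hj7 h43 (cover_c33 (by omega) (by omega) hp2) (checkM_c33 _) 0 (-1) le_rfl (by norm_num) (by norm_num) le_rfl
    exact ⟨fun hne => by linarith [hc.1 hne], fun hne => by linarith [hc.2 hne]⟩
  by_cases h : p ≤ 36 * n
  · rw [N_c35 (by omega) h]
    have hc := cell_minors_ts3 hn hj1 hj7 h43 (cover_c35 (by omega) (by omega) hp2) (checkM_c35 _) 0 (-1) le_rfl (by norm_num) (by norm_num) le_rfl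
    exact ⟨fun hne => by linarith [hc.1 hne], fun hne => by linarith [hc.2 hne]⟩
  by_cases h' : p ≤ 38 * n
  · rw [N_c36 (by omega) h']
    have hc := cell_minors_ts3 hn hj1 hj7 h43 (cover_c36 (by omega) (by omega) hp2) (checkM_c36 _) 0 0 le_rfl (by norm_num) le_rfl le_rfl
    exact ⟨fun hne => by linarith [hc.1 hne], fun hne => by linarith [hc.2 hne]⟩
  by_cases h : p ≤ 40 * n
  · rw [N_c38 (by omega) h]
    have hc := cell_minors_ts3 hn hj1 hj7 h43 (cover_c38 (by omega) (by omega) hp2) (checkM_c38 _) 0 0 le_rfl (by norm_num) le_rfl (by norm_num)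
    exact ⟨fun hne => by linarith [hc.1 hne], fun hne => by linarith [hc.2 hne]⟩
  by_cases h' : p ≤ 41 * n
  · rw [N_c40 (by omega) (by omega)]
    have hc := cell_minors_ts3 hn hj1 hj7 h43 (cover_c40 (by omega) (by omega) hp2) (checkM_c40 _) 0 0 le_rfl (by norm_num) le_rfl (by norm_num)
    exact ⟨fun hne => by linarith [hc.1 hne], fun hne => by linarith [minorPhat_c40 hn hj1 hj7 hprime (by omega) h' hne]⟩
  by_cases h : p ≤ 43 * n
  · rw [N_c40 (by omega) h]
    have hc := cell_minors_ts3 hn hj1 hj7 h43 (cover_c41 (by omega) (by omega) hp2) (checkM_c41 _) 0 0 le_rfl (by norm_num) le_rfl (by norm_num)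
    exact ⟨fun hne => by linarith [hc.1 hne], fun hne => by linarith [hc.2 hne]⟩
  · rw [N_gt43 (by omega)]
    have hc := cell_minors_ts3 hn hj1 hj7 h43 (cover_c43 (by omega) (by omega) hp2) (checkM_c43 _) 0 0 le_rfl (by norm_num) le_rfl (by norm_num)
    exact ⟨fun hne => by linarith [minorQ_c43 hn hj1 hj7 hprime (by omega) h64 hne], fun hne => by linarith [hc.2 hne]⟩

end Ray

end Summit.KontsevichZagierPeriods.Zeta5Search.StairTS3
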